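import Summits.Ventures.CertifiedManyBodySolver.Downfold.EmeryFermiFillingNCCOSubs
import Summits.Ventures.CertifiedManyBodySolver.Downfold.EmeryFermiFillingLa214
import Summits.Ventures.CertifiedManyBodySolver.Downfold.EmeryBoxesKSlicesB
import HarnessLib

/-!
# Nd₂₋ₓCeₓCuO₄ x = 0.15 (box Nd2CuO4-NCCO, (K) source rows; ELECTRON-doped: n_H = 0.85 ⇒ abFilling = 0.575 > ½): the typed 3BE one-body box `emeryBoxNCCOK26Src` ⇒ a CERTIFIED window for the object-E Fermi-surface `t′/t` of the σ three-band
# model at the box's own hole count — and a certified MODEL-FORM CEILING against the E row of record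

Venture CertifiedManyBodySolver, cell `pub/hubbard-downfold` (stage S1, HUMAN RULINGS D-0096/D-0098), seat hubbard-downfold-mod-4 (technique B = band level);
namespace `Summit.Ventures.CertifiedManyBodySolver.Downfold.Emery`. Everything PROVED; numerics decided by the kernel (`EmeryFermiFillingNCCOSubs`).
Same device as `EmeryFermiFillingLa214` / `EmeryFermiFillingHg1201` / `EmeryFermiFillingLSCO`.

THE STATEMENT (`emeryBoxNCCOK26Src_fsRatio_window`). For every parameter vector of `emeryBoxNCCOK26Src` (`EmeryBoxesKSlicesB`: the NCCO companion's ONE-BODY rows (T′ structure: t_pp′ = 0.02) with the DFT-level Δ_pd sub-range, n_H = 0.85 (electron doping x = 0.15), filling padded ±0.005: Δ_pd [1.0, 2.05] × t_pd [0.9, 1.29] × t_pp [0.52, 0.72] × t_pp′ [0.02, 0.02]; n_H ∈ [0.85, 0.85])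
and every Fermi energy ε with `abFilling(ε) = (2 − n_H)/2` (the σ-model antibonding band holds the box's own electrons):
**`t′/t = fsRatio(ε) ∈ [-0.3374, -0.1998]`** and **ε ∈ [1.18, 2.92]** (box units, eV above ε_d).

READING (certified): the box's object-E row of record `t′/t (E) ∈ [−0.62, −0.51]` (box Nd2CuO4-NCCO.md l.90) vs the σ-model Fermi-surface window [-0.3374, -0.1998] on the whole one-body box at its own hole count —
see the corollary below: DISJOINT ⇒ a certified MODEL-FORM CEILING (the d–p_x–p_y(+t_pp, t_pp′) model cannot produce the one-band Fermi-surface shape of record anywhere in the box;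
the axial Cu-4s / apical / reservoir channel of [PavariniEtAl2001] carries the rest); INSIDE ⇒ consistency; partial overlap ⇒ a cut by sub-box (table in the Subs file).

WHAT THIS IS NOT: not a statement that the material's parameters ARE in the box (SCREENING-GRADE provenance); the theorem certifies the REDUCTION STEP
of the σ d–p_x–p_y(+t_pp, t_pp′) model only; not the interaction (`U`) reduction; no phase sentence. Sources: [HybertsenSchluterChristensen1989, Eq. (1)];
[AndersenEtAl1995, §6]; [PavariniEtAl2001, Eq. (1)].
-/

noncomputable section

namespace Summit.Ventures.CertifiedManyBodySolver.Downfold.Emery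

open Real Set
open Summit.Ventures.CertifiedManyBodySolver.Downfold

/-- Per-spin antibonding filling from the box's hole count: `n_H ∈ [17/20, 17/20] ⇒ (2 − n_H)/2 ∈ [57/100, 29/50]`. [folklore] -/
theorem abFilling_rowNCCO_of_nHoles {nH f : ℝ} (h1 : (17 / 20 : ℝ) ≤ nH) (h2 : nH ≤ (17 / 20 : ℝ)) (hf : f = (2 - nH) / 2) :
    f ∈ Set.Icc (57 / 100 : ℝ) (29 / 50 : ℝ) := by
  rw [hf]; constructor <;> linarith

/-- **Nd₂₋ₓCeₓCuO₄ x = 0.15 (box Nd2CuO4-NCCO, (K) source rows; ELECTRON-doped: n_H = 0.85 ⇒ abFilling = 0.575 > ½): 3BE box ⇒ object-E `t′/t` window (raw coordinates)** at per-spin filling ∈ [0.57, 0.58]: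
`ε ∈ [1.18, 2.92]` and `t′/t ∈ [-0.3374, -0.1998]`. [folklore] -/
theorem nccoBox_fsRatio_window {Δ tpd tpp c ε : ℝ} (hΔ : Δ ∈ Set.Icc (1 : ℝ) (41 / 20 : ℝ))
    (ha : tpd ∈ Set.Icc (9 / 10 : ℝ) (129 / 100 : ℝ)) (hb : tpp ∈ Set.Icc (13 / 25 : ℝ) (18 / 25 : ℝ))
    (hc : c ∈ Set.Icc (1 / 50 : ℝ) (1 / 50 : ℝ))
    (hν : abFilling Δ tpd tpp c ε ∈ Set.Icc (57 / 100 : ℝ) (29 / 50 : ℝ)) :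
    ε ∈ Set.Icc (59 / 50 : ℝ) (73 / 25 : ℝ) ∧ fsRatio Δ tpd tpp c ε ∈ Set.Icc (-(1687 / 5000 : ℝ)) (-(999 / 5000 : ℝ)) := by
  have hΔ' := hΔ
  constructor
  · clear hΔ
    rcases mem_Icc_split hΔ' (61 / 40 : ℝ) with hΔ' | hΔ'
    · rcases mem_Icc_split hΔ' (101 / 80 : ℝ) with hΔ' | hΔ'
      · rcases mem_Icc_split ha (219 / 200 : ℝ) with ha' | ha'
        · have h := (nccoSub_0_0 hΔ' ha' hb hc hν).1
          exact ⟨le_trans (by norm_num) h.1, h.2.trans (by norm_num)⟩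
        · have h := (nccoSub_0_1 hΔ' ha' hb hc hν).1
          exact ⟨le_trans (by norm_num) h.1, h.2.trans (by norm_num)⟩
      · rcases mem_Icc_split ha (219 / 200 : ℝ) with ha' | ha'
        · have h := (nccoSub_1_0 hΔ' ha' hb hc hν).1
          exact ⟨le_trans (by norm_num) h.1, h.2.trans (by norm_num)⟩
        · have h := (nccoSub_1_1 hΔ' ha' hb hc hν).1
          exact ⟨le_trans (by norm_num) h.1, h.2.trans (by norm_num)⟩
    · rcases mem_Icc_split hΔ' (143 / 80 : ℝ) with hΔ' | hΔ'
      · rcases mem_Icc_split ha (219 / 200 : ℝ) with ha' | ha'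
        · have h := (nccoSub_2_0 hΔ' ha' hb hc hν).1
          exact ⟨le_trans (by norm_num) h.1, h.2.trans (by norm_num)⟩
        · have h := (nccoSub_2_1 hΔ' ha' hb hc hν).1
          exact ⟨le_trans (by norm_num) h.1, h.2.trans (by norm_num)⟩
      · rcases mem_Icc_split ha (219 / 200 : ℝ) with ha' | ha'
        · have h := (nccoSub_3_0 hΔ' ha' hb hc hν).1
          exact ⟨le_trans (by norm_num) h.1, h.2.trans (by norm_num)⟩
        · have h := (nccoSub_3_1 hΔ' ha' hb hc hν).1
          exact ⟨le_trans (by norm_num) h.1, h.2.trans (by norm_num)⟩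
  · clear hΔ
    rcases mem_Icc_split hΔ' (61 / 40 : ℝ) with hΔ' | hΔ'
    · rcases mem_Icc_split hΔ' (101 / 80 : ℝ) with hΔ' | hΔ'
      · rcases mem_Icc_split ha (219 / 200 : ℝ) with ha' | ha'
        · have h := (nccoSub_0_0 hΔ' ha' hb hc hν).2
          exact ⟨le_trans (by norm_num) h.1, h.2.trans (by norm_num)⟩
        · have h := (nccoSub_0_1 hΔ' ha' hb hc hν).2
          exact ⟨le_trans (by norm_num) h.1, h.2.trans (by norm_num)⟩
      · rcases mem_Icc_split ha (219 / 200 : ℝ) with ha' | ha'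
        · have h := (nccoSub_1_0 hΔ' ha' hb hc hν).2
          exact ⟨le_trans (by norm_num) h.1, h.2.trans (by norm_num)⟩
        · have h := (nccoSub_1_1 hΔ' ha' hb hc hν).2
          exact ⟨le_trans (by norm_num) h.1, h.2.trans (by norm_num)⟩
    · rcases mem_Icc_split hΔ' (143 / 80 : ℝ) with hΔ' | hΔ'
      · rcases mem_Icc_split ha (219 / 200 : ℝ) with ha' | ha'
        · have h := (nccoSub_2_0 hΔ' ha' hb hc hν).2
          exact ⟨le_trans (by norm_num) h.1, h.2.trans (by norm_num)⟩
        · have h := (nccoSub_2_1 hΔ' ha' hb hc hν).2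
          exact ⟨le_trans (by norm_num) h.1, h.2.trans (by norm_num)⟩
      · rcases mem_Icc_split ha (219 / 200 : ℝ) with ha' | ha'
        · have h := (nccoSub_3_0 hΔ' ha' hb hc hν).2
          exact ⟨le_trans (by norm_num) h.1, h.2.trans (by norm_num)⟩
        · have h := (nccoSub_3_1 hΔ' ha' hb hc hν).2
          exact ⟨le_trans (by norm_num) h.1, h.2.trans (by norm_num)⟩

/-- The five rows of `emeryBoxNCCOK26Src` this file reads. [folklore] -/
theorem emeryBoxNCCOK26Src_mem_rows {p : EmeryCoord → ℝ} (hp : emeryBoxNCCOK26Src.Mem p) :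
    p .DeltaPd ∈ Set.Icc (1 : ℝ) (41 / 20 : ℝ) ∧ p .tpd ∈ Set.Icc (9 / 10 : ℝ) (129 / 100 : ℝ) ∧
      p .tpp ∈ Set.Icc (13 / 25 : ℝ) (18 / 25 : ℝ) ∧ p .tppP ∈ Set.Icc (1 / 50 : ℝ) (1 / 50 : ℝ) ∧
      p .nHoles ∈ Set.Icc (17 / 20 : ℝ) (17 / 20 : ℝ) := by
  have hΔ := (Entry.mem_ofEnds_iff _ _ _ _ _).1 (hp .DeltaPd nccoK26Emery_DeltaKS rfl)
  have ha := (Entry.mem_ofEnds_iff _ _ _ _ _).1 (hp .tpd nccoK26Emery_tpd rfl)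
  have hb := (Entry.mem_ofEnds_iff _ _ _ _ _).1 (hp .tpp nccoK26Emery_tpp rfl)
  have hc := (Entry.mem_ofEnds_iff _ _ _ _ _).1 (hp .tppP nccoK26Emery_tppP rfl)
  have hn := (Entry.mem_ofEnds_iff _ _ _ _ _).1 (hp .nHoles nccoK26Emery_nH rfl)
  push_cast at hΔ ha hb hc hn
  exact ⟨⟨hΔ.1, hΔ.2⟩, ⟨ha.1, ha.2⟩, ⟨hb.1, hb.2⟩, ⟨hc.1, hc.2⟩, ⟨hn.1, hn.2⟩⟩

/-- **THE WORD ON THE TYPED BOX `emeryBoxNCCOK26Src`**: at every parameter vector and every Fermi energy at which the σ-model antibonding band holds the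
box's own electron count, `ε ∈ [1.18, 2.92]` and the exact σ-model Fermi-surface `t′/t ∈ [-0.3374, -0.1998]`.
[cite: HybertsenSchluterChristensen1989, Eq. (1) (three-band d–p model)] -/
theorem emeryBoxNCCOK26Src_fsRatio_window :
    HoldsOn (fun p : EmeryCoord → ℝ => ∀ ε : ℝ,
      abFilling (p .DeltaPd) (p .tpd) (p .tpp) (p .tppP) ε = (2 - p .nHoles) / 2 →
      ε ∈ Set.Icc (59 / 50 : ℝ) (73 / 25 : ℝ) ∧
      fsRatio (p .DeltaPd) (p .tpd) (p .tpp) (p .tppP) ε ∈ Set.Icc (-(1687 / 5000 : ℝ)) (-(999 / 5000 : ℝ))) emeryBoxNCCOK26Src := by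
  intro p hp ε hf
  obtain ⟨hΔ, ha, hb, hc, hn⟩ := emeryBoxNCCOK26Src_mem_rows hp
  exact nccoBox_fsRatio_window hΔ ha hb hc (abFilling_rowNCCO_of_nHoles hn.1 hn.2 hf)

/-- **MODEL-FORM CEILING, CERTIFIED**: on the whole box the σ-model Fermi-surface `t′/t` window [-0.3374, -0.1998] is DISJOINT from the object-E
row of record `[-0.62, -0.51]` (router/BOXES/Nd2CuO4-NCCO.md l.90 «tp/t (E) [−0.62, −0.51]») — the d–p_x–p_y(+t_pp, t_pp′) model cannot produce this material's one-band Fermi-surface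
shape anywhere in its 3BE box. [folklore] -/
theorem emeryBoxNCCOK26Src_fsRatio_not_objectE :
    HoldsOn (fun p : EmeryCoord → ℝ => ∀ ε : ℝ,
      abFilling (p .DeltaPd) (p .tpd) (p .tpp) (p .tppP) ε = (2 - p .nHoles) / 2 →
      fsRatio (p .DeltaPd) (p .tpd) (p .tpp) (p .tppP) ε ∉ Set.Icc (-(31 / 50 : ℝ)) (-(51 / 100 : ℝ))) emeryBoxNCCOK26Src := by
  intro p hp ε hf hmem
  have h := (emeryBoxNCCOK26Src_fsRatio_window p hp ε hf).2
  have : (-(51 / 100 : ℝ)) < (-(1687 / 5000 : ℝ)) := by norm_num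
  linarith [h.1, hmem.2]

end Summit.Ventures.CertifiedManyBodySolver.Downfold.Emery
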